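import Summits.CriticalPhenomena.PercolationContinuityZ3.Theorems.PercNearOneGluingNoHeavyQuantFarSunLayerTwoAll
import Summits.CriticalPhenomena.PercolationContinuityZ3.Theorems.PercNearOneGluingNoHeavyQuantFarSunCertElevenTwoD
import HarnessLib

/-!
# FAR beyond trees: LAYER 2 OF FAR ON EVERY HAIRY CYCLE — `∀ K ≥ 2, SunFAR K 2` (`sunFAR_two_all`)

builds on p205010 (kernel theorem, internal audit signed; external expert review pending)

Support file (`--supports stmt-CriticalPhenomena-4575`), seat `prim-cert-1` (gen 39); memo `prim-cert-1/FROM-prim-cert-1-g39-VERTEX-GAME.md` §8.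
The three pieces: `K ≤ 10` — the per-`K` kernel certificates (`HairyCycle.sunFAR_of_le_ten`, …RowLeTen); `K = 11` — the Kronecker-shard certificate
`HairyCycle.sunFAR_eleven_two` (…CertElevenTwoD); `K ≥ 12` — the vertex principle + delay-2 information games + universal witnesses
(`HairyCycle.sunFAR_two_of_ge_twelve`, …LayerTwoAll).  **`HairyCycle.sunFAR_two_all`** (the name `sunFAR_two` is the `K = 2` row lemma of …RowLeSeven).  Elementary [this work]; no sorries; axioms standard + `Lean.ofReduceBool`
through the computational certificates.
-/

namespace Summit.CriticalPhenomena.PercolationContinuityZ3.Theorems.HairyCycle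

/-- **LAYER 2 OF FAR: `SunFAR K 2` for every hairy cycle (`K ≥ 2`).** [this work] -/
theorem sunFAR_two_all {K : ℕ} (hK : 2 ≤ K) : SunFAR K 2 := by
  by_cases h11 : K = 11
  · subst h11; exact sunFAR_eleven_two
  · exact sunFAR_two_of_ne_eleven hK h11

end Summit.CriticalPhenomena.PercolationContinuityZ3.Theorems.HairyCycle
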